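import Summits.CriticalPhenomena.CardyFormulaZ2.Theorems.CardySelfRefinementLagHandOffDiscretisableLabelling
import HarnessLib

/-!
# From labellings to a discretisation family WITH IDENTIFIED DISCRETE ARCS: helper for stub
`stub_discreteSplitting` of line `hitting-tournament` for crux `LagHandOff` (stmt-CriticalPhenomena-10268)

`zdDiscretisationFamily_of_labelling_arcs`: lead-0's marker-free reduction
`zdDiscretisationFamily_of_labelling` (`…DiscretisableLabelling.lean`) re-run with ONE extra output —
the discrete arcs of the family produced are, for all small meshes, exactly the given label classes
`SA δ`, `SB δ` (this is what `exists_markers_of_labelling` provides at every mesh; the original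
statement forgets it).  The target-independence assembly needs the identification to compare the
completed configurations of two families built from nested labellings.
-/

noncomputable section

open MeasureTheory Filter Set Topology
open scoped BoundedContinuousFunction
open Literature.Probability.Percolation Literature.Probability.LatticeModels
open Literature.Probability.RandomPlanarGeometry Literature.Probability.Percolation.QuadCrossing
open Summit.CriticalPhenomena.CardyFormulaZ2.Cruxes.LagHandOff.CrosscutDictionary

namespace Summit.CriticalPhenomena.CardyFormulaZ2.Cruxes.LagHandOff.HittingTournament

-- adapted from Theorems/CardySelfRefinementLagHandOffDiscretisableLabelling.lean
-- (`zdDiscretisationFamily_of_labelling`), keeping the identification of the discrete arcs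
set_option maxHeartbeats 1600000 in
/-- **From labellings to a discretisation family with identified arcs.** Under the hypotheses of
`zdDiscretisationFamily_of_labelling`, there are marker families `A, B` such that
`δ ↦ ⟨D.carrier, δ, A δ, B δ⟩` is a `ZdDiscretisationFamily` of `D` whose discrete arcs are, for
all small meshes, exactly `SA δ` and `SB δ`. -/
theorem zdDiscretisationFamily_of_labelling_arcs (D : DobrushinDomain) (SA SB : ℝ → Set (Site 2))
    (ε : ℝ → ℝ) (hε : Tendsto ε (𝓝[>] 0) (𝓝 0))
    (hlab : ∀ᶠ δ in 𝓝[>] (0 : ℝ),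
      SA δ ∪ SB δ = (⟨D.carrier, δ, ∅, ∅⟩ : DiscreteDobrushin).zdBoundary ∧
      Disjoint (SA δ) (SB δ) ∧ (SA δ).Nonempty ∧ (SB δ).Nonempty ∧
      (∀ y ∈ SA δ, ¬ Metric.closedBall (meshPoint δ y)
          (Metric.infDist (meshPoint δ y) (frontier D.carrier)) ⊆
        ⋃ x ∈ SB δ, Metric.closedBall (meshPoint δ x)
          (Metric.infDist (meshPoint δ x) (frontier D.carrier))) ∧
      (∀ x ∈ SB δ, ¬ Metric.closedBall (meshPoint δ x)
          (Metric.infDist (meshPoint δ x) (frontier D.carrier)) ⊆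
        ⋃ y ∈ SA δ, Metric.closedBall (meshPoint δ y)
          (Metric.infDist (meshPoint δ y) (frontier D.carrier))) ∧
      (∀ y ∈ SA δ, Metric.infDist (meshPoint δ y) (D.arc 0) ≤ ε δ) ∧
      (∀ x ∈ SB δ, Metric.infDist (meshPoint δ x) (D.arc 1) ≤ ε δ) ∧
      {e | e ∈ (discreteDomainGraph D.carrier δ).edgeSet ∧ (∃ x ∈ e, x ∈ SA δ) ∧
        ∃ y ∈ e, y ∈ SB δ}.ncard = 2 ∧
      ∀ e ∈ (discreteDomainGraph D.carrier δ).edgeSet, (∃ x ∈ e, x ∈ SA δ) → (∃ y ∈ e, y ∈ SB δ) →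
        ∃! f, (⟨D.carrier, δ, ∅, ∅⟩ : DiscreteDobrushin).IsInnerFace f ∧ ∀ x ∈ e, IsCorner x f)
    (hpts : Tendsto (fun δ => Metric.hausdorffEDist (medialPoint δ ''
        {e | e ∈ (discreteDomainGraph D.carrier δ).edgeSet ∧ (∃ x ∈ e, x ∈ SA δ) ∧
          ∃ y ∈ e, y ∈ SB δ}) {D.pt 0, D.pt 1}) (𝓝[>] 0) (𝓝 0)) :
    ∃ A B : ℝ → Set ℂ,
      ZdDiscretisationFamily D (fun δ => (⟨D.carrier, δ, A δ, B δ⟩ : DiscreteDobrushin)) ∧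
      ∀ᶠ δ in 𝓝[>] (0 : ℝ), (⟨D.carrier, δ, A δ, B δ⟩ : DiscreteDobrushin).zdArcA = SA δ ∧
        (⟨D.carrier, δ, A δ, B δ⟩ : DiscreteDobrushin).zdArcB = SB δ := by
  -- a positive majorant of `ε` still tending to `0`
  set ε' : ℝ → ℝ := fun δ => max (ε δ) δ with hε'
  have hε't : Tendsto ε' (𝓝[>] 0) (𝓝 0) := by
    have h2 : Tendsto (fun δ : ℝ => δ) (𝓝[>] (0 : ℝ)) (𝓝 0) :=
      tendsto_nhdsWithin_of_tendsto_nhds tendsto_id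
    simpa using hε.max h2
  have hδpos : ∀ᶠ δ in 𝓝[>] (0 : ℝ), 0 < δ := self_mem_nhdsWithin
  -- markers at every good mesh
  have key : ∀ δ : ℝ, 0 < δ →
      (SA δ ∪ SB δ = (⟨D.carrier, δ, ∅, ∅⟩ : DiscreteDobrushin).zdBoundary ∧
      Disjoint (SA δ) (SB δ) ∧ (SA δ).Nonempty ∧ (SB δ).Nonempty ∧
      (∀ y ∈ SA δ, ¬ Metric.closedBall (meshPoint δ y)
          (Metric.infDist (meshPoint δ y) (frontier D.carrier)) ⊆
        ⋃ x ∈ SB δ, Metric.closedBall (meshPoint δ x)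
          (Metric.infDist (meshPoint δ x) (frontier D.carrier))) ∧
      (∀ x ∈ SB δ, ¬ Metric.closedBall (meshPoint δ x)
          (Metric.infDist (meshPoint δ x) (frontier D.carrier)) ⊆
        ⋃ y ∈ SA δ, Metric.closedBall (meshPoint δ y)
          (Metric.infDist (meshPoint δ y) (frontier D.carrier))) ∧
      (∀ y ∈ SA δ, Metric.infDist (meshPoint δ y) (D.arc 0) ≤ ε δ) ∧
      (∀ x ∈ SB δ, Metric.infDist (meshPoint δ x) (D.arc 1) ≤ ε δ) ∧
      {e | e ∈ (discreteDomainGraph D.carrier δ).edgeSet ∧ (∃ x ∈ e, x ∈ SA δ) ∧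
        ∃ y ∈ e, y ∈ SB δ}.ncard = 2 ∧
      ∀ e ∈ (discreteDomainGraph D.carrier δ).edgeSet, (∃ x ∈ e, x ∈ SA δ) → (∃ y ∈ e, y ∈ SB δ) →
        ∃! f, (⟨D.carrier, δ, ∅, ∅⟩ : DiscreteDobrushin).IsInnerFace f ∧ ∀ x ∈ e, IsCorner x f) →
      ∃ A B : Set ℂ, (⟨D.carrier, δ, A, B⟩ : DiscreteDobrushin).zdArcA = SA δ ∧
        (⟨D.carrier, δ, A, B⟩ : DiscreteDobrushin).zdArcB = SB δ ∧
        Metric.hausdorffEDist A (D.arc 0) ≤ ENNReal.ofReal (2 * ε' δ) ∧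
        Metric.hausdorffEDist B (D.arc 1) ≤ ENNReal.ofReal (2 * ε' δ) := by
    intro δ hδ h
    obtain ⟨hunion, -, hAne, hBne, hNFA, hNFB, hA0, hB1, -, -⟩ := h
    exact exists_markers_of_labelling D hδ (lt_max_of_lt_right hδ) hunion hAne hBne hNFA hNFB
      (fun y hy => (hA0 y hy).trans (le_max_left _ _)) (fun x hx => (hB1 x hx).trans (le_max_left _ _))
  choose! A B hAB using key
  -- on good meshes: arcs, `A`–`B` edges, admissibility
  have hgood : ∀ᶠ δ in 𝓝[>] (0 : ℝ), (⟨D.carrier, δ, A δ, B δ⟩ : DiscreteDobrushin).zdArcA = SA δ ∧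
      (⟨D.carrier, δ, A δ, B δ⟩ : DiscreteDobrushin).zdArcB = SB δ ∧
      Metric.hausdorffEDist (A δ) (D.arc 0) ≤ ENNReal.ofReal (2 * ε' δ) ∧
      Metric.hausdorffEDist (B δ) (D.arc 1) ≤ ENNReal.ofReal (2 * ε' δ) ∧
      (⟨D.carrier, δ, A δ, B δ⟩ : DiscreteDobrushin).zdABEdges =
        {e | e ∈ (discreteDomainGraph D.carrier δ).edgeSet ∧
          (∃ x ∈ e, x ∈ SA δ) ∧ ∃ y ∈ e, y ∈ SB δ} ∧
      (⟨D.carrier, δ, A δ, B δ⟩ : DiscreteDobrushin).IsZdAdmissible := by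
    filter_upwards [hδpos, hlab] with δ hδ h
    obtain ⟨hA, hB, hHA, hHB⟩ := hAB δ hδ h
    obtain ⟨hunion, hdisj, hAne, hBne, -, -, -, -, hcard, hinner⟩ := h
    have hcross : (⟨D.carrier, δ, A δ, B δ⟩ : DiscreteDobrushin).zdABEdges =
        {e | e ∈ (discreteDomainGraph D.carrier δ).edgeSet ∧
          (∃ x ∈ e, x ∈ SA δ) ∧ ∃ y ∈ e, y ∈ SB δ} := by
      ext e
      rw [DiscreteDobrushin.mem_zdABEdges_iff, hA, hB]
      rfl
    refine ⟨hA, hB, hHA, hHB, hcross, ?_⟩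
    exact
      { isBounded := D.isBounded
        delta_pos := hδ
        zdArcA_nonempty := hA ▸ hAne
        zdArcB_nonempty := hB ▸ hBne
        disjoint := by rw [hA, hB]; exact hdisj
        zdBoundary_subset := by
          rw [hA, hB]
          intro x hx
          rw [hunion]
          exact hx
        ncard_zdABEdges_eq_two := by rw [hcross]; exact hcard
        zdABEdges_inner := by
          rw [hcross]
          rintro e ⟨he, hxA, hyB⟩
          exact hinner e he hxA hyB }
  refine ⟨A, B, (zdDiscretisationFamily_mk_iff D A B).2 ⟨?_, ?_, ?_, hgood.mono fun δ h => h.2.2.2.2.2⟩,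
    hgood.mono fun δ h => ⟨h.1, h.2.1⟩⟩
  · -- Hausdorff convergence of the `A`-markers: squeeze under `2 ε' → 0`
    have hup : Tendsto (fun δ => ENNReal.ofReal (2 * ε' δ)) (𝓝[>] 0) (𝓝 0) := by
      have := ENNReal.tendsto_ofReal (hε't.const_mul 2)
      simpa using this
    refine tendsto_of_tendsto_of_tendsto_of_le_of_le' tendsto_const_nhds hup
      (Eventually.of_forall fun _ => zero_le) (hgood.mono fun δ h => h.2.2.1)
  · have hup : Tendsto (fun δ => ENNReal.ofReal (2 * ε' δ)) (𝓝[>] 0) (𝓝 0) := by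
      have := ENNReal.tendsto_ofReal (hε't.const_mul 2)
      simpa using this
    refine tendsto_of_tendsto_of_tendsto_of_le_of_le' tendsto_const_nhds hup
      (Eventually.of_forall fun _ => zero_le) (hgood.mono fun δ h => h.2.2.2.1)
  · refine hpts.congr' (hgood.mono fun δ h => ?_)
    beta_reduce
    rw [h.2.2.2.2.1]

/-! ### Registered sub-goal (one-line signature, verbatim) -/

/-- **Registered sub-goal `stub_discreteSplitting_ofLabellingArcs` of `stub_discreteSplitting`**:
`zdDiscretisationFamily_of_labelling_arcs`, fully quantified. -/
theorem stub_discreteSplitting_ofLabellingArcs : ∀ (D : DobrushinDomain) (SA SB : ℝ → Set (Site 2)) (ε : ℝ → ℝ), Tendsto ε (𝓝[>] 0) (𝓝 0) → (∀ᶠ δ in 𝓝[>] (0 : ℝ), SA δ ∪ SB δ = (⟨D.carrier, δ, ∅, ∅⟩ : DiscreteDobrushin).zdBoundary ∧ Disjoint (SA δ) (SB δ) ∧ (SA δ).Nonempty ∧ (SB δ).Nonempty ∧ (∀ y ∈ SA δ, ¬ Metric.closedBall (meshPoint δ y) (Metric.infDist (meshPoint δ y) (frontier D.carrier)) ⊆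 ⋃ x ∈ SB δ, Metric.closedBall (meshPoint δ x) (Metric.infDist (meshPoint δ x) (frontier D.carrier))) ∧ (∀ x ∈ SB δ, ¬ Metric.closedBall (meshPoint δ x) (Metric.infDist (meshPoint δ x) (frontier D.carrier)) ⊆ ⋃ y ∈ SA δ, Metric.closedBall (meshPoint δ y) (Metric.infDist (meshPoint δ y) (frontier D.carrier))) ∧ (∀ y ∈ SA δ, Metric.infDist (meshPoint δ y) (D.arc 0) ≤ ε δ) ∧ (∀ x ∈ SB δ, Metric.infDist (meshPoint δ x) (D.arc 1) ≤ ε δ) ∧ {e | e ∈ (discreteDomainGraph D.carrier δ).edgeSet ∧ (∃ x ∈ e, x ∈ SA δ) ∧ ∃ y ∈ e, y ∈ SB δ}.ncard = 2 ∧ ∀ e ∈ (discreteDomainGraph D.carrier δ).edgeSet, (∃ x ∈ e, x ∈ SA δ) → (∃ y ∈ e, y ∈ SB δ) → ∃! f, (⟨D.carrier, δ, ∅, ∅⟩ : DiscreteDobrushin).IsInnerFace f ∧ ∀ x ∈ e, IsCorner x f) → Tendsto (fun δ => Metric.hausdorffEDist (medialPoint δ '' {e | e ∈ (discreteDomainGraph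 D.carrier δ).edgeSet ∧ (∃ x ∈ e, x ∈ SA δ) ∧ ∃ y ∈ e, y ∈ SB δ}) {D.pt 0, D.pt 1}) (𝓝[>] 0) (𝓝 0) → ∃ A B : ℝ → Set ℂ, ZdDiscretisationFamily D (fun δ => (⟨D.carrier, δ, A δ, B δ⟩ : DiscreteDobrushin)) ∧ ∀ᶠ δ in 𝓝[>] (0 : ℝ), (⟨D.carrier, δ, A δ, B δ⟩ : DiscreteDobrushin).zdArcA = SA δ ∧ (⟨D.carrier, δ, A δ, B δ⟩ : DiscreteDobrushin).zdArcB = SB δ :=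
  fun D SA SB ε hε hlab hpts => zdDiscretisationFamily_of_labelling_arcs D SA SB ε hε hlab hpts

end Summit.CriticalPhenomena.CardyFormulaZ2.Cruxes.LagHandOff.HittingTournament

end
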